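import Summits.BirchSwinnertonDyer.BirchSwinnertonDyer.Theorems.EisensteinPrimesGoodLatticeBDPValueOfNamedFactsV34
import Summits.BirchSwinnertonDyer.BirchSwinnertonDyer.Theorems.EisensteinPrimesGoodLatticeKatzFrameOfExistsFrame
import HarnessLib

/-!
# Crux `GoodLatticeBDPValue` (stmt-BirchSwinnertonDyer-19032), line `halves` v34N: THE CRUX BY NAME FROM SIX `∃`-SHAPED
# PUBLISHED STATEMENTS — the by-name closure of record (p763736, seven names) with its two `∀`-frame names
# (`thmI_…`, `proofThm221_…`) REPLACED by their `∃`-frame (print-shaped) forms; `thm212_…` is then a projection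
# (helper file 4 for crux 2; `--supports stmt-BirchSwinnertonDyer-19032`; closes nothing by itself)

Cell `bsd-eis` (run/shared/lean/pub/bsd-eis/), width seat `bsd-line-x1-p1-w2` gen 31. Pure composition over landed theorems
(0 definitions, 0 named facts, 0 `sorry`): `GoodLatticeBDPValueOfNamedFactsV34.goodLatticeBDPValue_of_namedFacts₃₄` (g27, p763736)
∘ `GoodLatticeKatzFrameRigidity.thmI_mu_katzLFunction_eq_zero_of_exists_frame` /
`GoodLatticeKatzFrameRigidity.proofThm221_congruence_of_existsFramePair` (this seat, p768107).

WHAT. The closure of record takes the seven published names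
`(proofThm422 ∧ thm513 ∧ thm331 ∧ thmII64) ∧ thm212`, `proofThm221`, `thmI`. On the PERIOD axis four of them are `∃`-frame
statements (print-shaped), `thm212` is a pure existence statement, and two — `thmI` (Hida 2010 Thm. I) and `proofThm221` (CGLS 2022
proof of Thm. 2.2.1) — are phrased for EVERY frame at ANY period pair. Files 1–3 of this seat proved that these two FOLLOW from their
`∃`-frame forms (Katz span rigidity). Hence:
* `thm212_of_exists_frame_form` — `thm212_exists_isKatzLFunction` is the projection of the `∃`-frame form of `thmI` (same binders;
  drop the `μ`-clause);
* `goodLatticeBDPValue_of_existsFrameForms` — the crux decl `Theses.EisensteinPrimes.GoodLatticeBDPValue` from SIX statements each of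
  which is `∃`-shaped on the period axis: the four-conjunct cite block `proofThm422 ∧ thm513 ∧ thm331 ∧ thmII64` (as in the registered
  cite stub `stub_printInputs`), the `∃`-frame form «CGLS Thm. 2.1.2 existence + Hida Thm. I for THAT object», and the `∃`-frame-pair
  form of CGLS's proof of Thm. 2.2.1;
* `thm308_imc2_bdpValue_goodLattice_OPEN_of_existsFrameForms` — the same on the Literature `Prop` (the crux's signature).

HONEST FRAMING: CONDITIONAL on exactly these six hypotheses (audit `proof.conditional`); `thmII64_…` keeps its `∀`-frame phrasing (two-variable;
the tree's rigidity `span_eq_span_of_isKatzMeasure₂` is narrower than its binders — recorded, not repaired here); closes nothing by itself; the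
registry (halves v34N, 2 cite-only stubs) is untouched; no summit statement / BSD / Mazur MC / IMC2 / theorem of CGLS, Hida, Kriz, Rubin, de Shalit
or Keller–Yin is proved here for any curve; 0 cells / labels / tiers move.
[cite: KellerYin2024, Thm. 3.0.8 (IMC2) — statement shape] [cite: CastellaGrossiLeeSkinner2022, proof of Thm. 4.2.2, Thm. 5.1.3 with (disc), Thm. 2.1.2, Thm. 2.2.1 and its proof (arXiv:2008.02571v2 TeX L1051–1116)]
[cite: Hida2010MuInvariant, Thm. I (p. 45)] [cite: BleherEtAl2020, §3.3 Thm. 3.3.1] [cite: deShalit1987, II.6.4 Theorem (i)] [cite: Kriz2016, Def. 31, Rem. 32]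
-/

noncomputable section

set_option autoImplicit false
set_option linter.dupNamespace false

namespace Summit.BirchSwinnertonDyer.BirchSwinnertonDyer.Theorems.GoodLatticeBDPValueOfExistsFrameForms

open PowerSeries WeierstrassCurve NumberField IsDedekindDomain Field
  Literature.NumberTheory.EllipticCurves Literature.NumberTheory.EllipticCurves.Rank1Residual
  Literature.NumberTheory.EllipticCurves.ModularForms
  Literature.NumberTheory.GaloisRepresentations Literature.NumberTheory.QuadraticFields
  Literature.NumberTheory.EllipticCurves.CastellaGrossiLeeSkinner2022 Literature.NumberTheory.EllipticCurves.BCGKPST2020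
  Literature.NumberTheory.EllipticCurves.DeShalit1987 Literature.NumberTheory.EllipticCurves.KellerYin2024
  Literature.NumberTheory.EllipticCurves.Hida2010MuInvariant
  Summit.BirchSwinnertonDyer.BirchSwinnertonDyer.Theorems

/-- **`thm212_exists_isKatzLFunction` is the projection of the `∃`-frame form of Hida's Theorem I** (same binders; forget the
`μ`-clause). [cite: CastellaGrossiLeeSkinner2022, Thm. 2.1.2 (arXiv:2008.02571v2 TeX L1015–1041)] -/
theorem thm212_of_exists_frame_form
    (H :
        ∀ (p : ℕ) [Fact p.Prime], 2 < p →
          ∀ (K : Type) [Field K] [NumberField K], IsImaginaryQuadratic K →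
            SatisfiesHeegnerHypothesis p K → Odd (NumberField.discr K) → NumberField.discr K ≠ -3 →
          ∀ (ι : K →+* ℚ_[p]) (v vbar : HeightOneSpectrum (𝓞 K)),
            (∀ x : 𝓞 K, x ∈ v.asIdeal ↔ ‖ι (x : K)‖ < 1) →
            ((p : ℕ) : 𝓞 K) ∈ vbar.asIdeal → vbar ≠ v →
          ∀ (κ : ZpExtension K p), κ.IsAnticyclotomic →
          ∀ (γ : absoluteGaloisGroup K) [Fact (κ.IsTopGenerator γ)],
          ∀ (ι' : PadicAlgCl p ≃+* ℂ),
            (∀ (w : InfinitePlace K) (k : 𝓞 K), k ∈ v.asIdeal ↔ ‖ι'.symm (w.embedding (k : K))‖ < 1) →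
          ∀ (θ : FramedGaloisRep ℚ (padicCoeffIntegers (∅ : Set (PadicAlgCl p))) 1),
            (∀ σ : absoluteGaloisGroup ℚ, θ σ ^ (p - 1) = 1) →
          ∀ (C : ℕ), SatisfiesHeegnerHypothesis C K →
            (∀ u : HeightOneSpectrum (𝓞 ℚ), ((C : ℤ) : 𝓞 ℚ) ∉ u.asIdeal → θ.IsUnramifiedAt u) →
            (∀ u : HeightOneSpectrum (𝓞 ℚ), ((p : ℕ) : 𝓞 ℚ) ∈ u.asIdeal → θ.IsUnramifiedAt u) →
          ∀ (θK : HeckeCharacter K), IsHeckeCharOf ι' (θ.restrictField K) θK →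
          ∃ (ΩK : ℂ) (Ωp : (unrIntegers p)ˣ) (L : UnrSeries p), ΩK ≠ 0 ∧
            IsKatzLFunction ι' v vbar ∅ κ γ θK ΩK ((Ωp : unrIntegers p) : ℂ_[p]) L ∧ ∃ n : ℕ, FirstUnitCoeffAt L n) :
    thm212_exists_isKatzLFunction := by
  unfold thm212_exists_isKatzLFunction
  intro p _ hp2 K _ _ hK hHeeg hodd hd3 ι v vbar hv hvbar hne κ hκ γ hγ ι' hι' θ hθ C hC hθC hθp θK hθK
  obtain ⟨ΩK, Ωp, L, hΩK, hL, -⟩ :=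
    H p hp2 K hK hHeeg hodd hd3 ι v vbar hv hvbar hne κ hκ γ ι' hι' θ hθ C hC hθC hθp θK hθK
  exact ⟨ΩK, Ωp, L, hΩK, hL⟩

/-- **THE CRUX DECL BY NAME — `Theses.EisensteinPrimes.GoodLatticeBDPValue` — from SIX statements, each `∃`-shaped on the period
axis**: the four-conjunct cite block (CGLS 2022 proof of Thm. 4.2.2, Thm. 5.1.3 (disc); Bleher et al. 2020 Thm. 3.3.1; de Shalit 1987
II.6.4 — verbatim the first conjunct of the registered cite stub `stub_printInputs`), the `∃`-frame form «CGLS Thm. 2.1.2 existence +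
Hida 2010 Thm. I for THAT frame», and the `∃`-frame-pair form of CGLS's proof of Thm. 2.2.1. Body: g27's closure of record on
`thm212_of_exists_frame_form`, `proofThm221_congruence_of_existsFramePair`, `thmI_mu_katzLFunction_eq_zero_of_exists_frame`.
CONDITIONAL on exactly these six hypotheses; closes nothing by itself; BSD is proved for no curve.
[cite: KellerYin2024, Thm. 3.0.8 (IMC2) — statement shape] [cite: CastellaGrossiLeeSkinner2022, proof of Thm. 4.2.2, Thm. 5.1.3 with (disc), Thm. 2.1.2, Thm. 2.2.1 and its proof]
[cite: Hida2010MuInvariant, Thm. I] [cite: BleherEtAl2020, §3.3 Thm. 3.3.1] [cite: deShalit1987, II.6.4 Theorem (i)] -/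
theorem goodLatticeBDPValue_of_existsFrameForms
    (h4 : proofThm422_exists_isBDPLFunction_isTorsion_charIdeal_dvd ∧
      thm513_exists_isBDPLFunction_valueAtOne_disc ∧
      thm331_rubin_exists_katzMeasure₂_pseudoIso_span_eq ∧
      thmII64_katzMeasure₂_functionalEquation)
    (hIex :
        ∀ (p : ℕ) [Fact p.Prime], 2 < p →
          ∀ (K : Type) [Field K] [NumberField K], IsImaginaryQuadratic K →
            SatisfiesHeegnerHypothesis p K → Odd (NumberField.discr K) → NumberField.discr K ≠ -3 →
          ∀ (ι : K →+* ℚ_[p]) (v vbar : HeightOneSpectrum (𝓞 K)),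
            (∀ x : 𝓞 K, x ∈ v.asIdeal ↔ ‖ι (x : K)‖ < 1) →
            ((p : ℕ) : 𝓞 K) ∈ vbar.asIdeal → vbar ≠ v →
          ∀ (κ : ZpExtension K p), κ.IsAnticyclotomic →
          ∀ (γ : absoluteGaloisGroup K) [Fact (κ.IsTopGenerator γ)],
          ∀ (ι' : PadicAlgCl p ≃+* ℂ),
            (∀ (w : InfinitePlace K) (k : 𝓞 K), k ∈ v.asIdeal ↔ ‖ι'.symm (w.embedding (k : K))‖ < 1) →
          ∀ (θ : FramedGaloisRep ℚ (padicCoeffIntegers (∅ : Set (PadicAlgCl p))) 1),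
            (∀ σ : absoluteGaloisGroup ℚ, θ σ ^ (p - 1) = 1) →
          ∀ (C : ℕ), SatisfiesHeegnerHypothesis C K →
            (∀ u : HeightOneSpectrum (𝓞 ℚ), ((C : ℤ) : 𝓞 ℚ) ∉ u.asIdeal → θ.IsUnramifiedAt u) →
            (∀ u : HeightOneSpectrum (𝓞 ℚ), ((p : ℕ) : 𝓞 ℚ) ∈ u.asIdeal → θ.IsUnramifiedAt u) →
          ∀ (θK : HeckeCharacter K), IsHeckeCharOf ι' (θ.restrictField K) θK →
          ∃ (ΩK : ℂ) (Ωp : (unrIntegers p)ˣ) (L : UnrSeries p), ΩK ≠ 0 ∧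
            IsKatzLFunction ι' v vbar ∅ κ γ θK ΩK ((Ωp : unrIntegers p) : ℂ_[p]) L ∧ ∃ n : ℕ, FirstUnitCoeffAt L n)
    (h221ex :
        ∀ (W : WeierstrassCurve ℚ) [W.IsElliptic] [W.IsGloballyMinimal] (p : ℕ) [Fact p.Prime],
          2 < p → Good W p →
          -- `E[p]^{ss} ≅ 𝔽_p(φ) ⊕ 𝔽_p(ψ)`: a rational line `Φ ≤ E[p]` with Teichmüller lifts `θsub = ψ̃` (on `Φ`) and
          -- `θquot = φ̃` (on `E[p]/Φ`); "labeled so that `p ∤ cond(φ)`": `θquot` unramified at `p`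
          ∀ (Φ : AddSubgroup (geomTorsion W (p : ℤ))), IsRationalLine W p Φ →
          ∀ (θsub θquot : FramedGaloisRep ℚ (padicCoeffIntegers (∅ : Set (PadicAlgCl p))) 1),
            IsTeichmullerLiftOn (∅ : Set (PadicAlgCl p)) (Φ.map (geomTorsion W (p : ℤ)).subtype) θsub →
            IsTeichmullerLiftOnQuot (∅ : Set (PadicAlgCl p)) (Φ.map (geomTorsion W (p : ℤ)).subtype)
              (geomTorsion W (p : ℤ)) θquot →
            (∀ u : HeightOneSpectrum (𝓞 ℚ), ((p : ℕ) : 𝓞 ℚ) ∈ u.asIdeal → θquot.IsUnramifiedAt u) →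
          -- (eq:cong-mf) `f ≡ E₂^{φ,φ⁻¹,(N)} (mod p)` ⟸ FULL Eisenstein descent of type `(φ̃, φ̃⁻¹, N₊, N₋, N₀)` mod `p`
          -- (Kriz 2016 Def. 31 with Rem. 32): the TYPE — `N₀` = the additive primes (squarefull part), `N₊ ⊔ N₋` = the
          -- multiplicative primes (squarefree part) of `N_E`
          ∀ (Nplus Nminus Nzero : Finset ℕ),
            Nplus ⊆ (W.conductorNorm ℤ).primeFactors → Nminus ⊆ (W.conductorNorm ℤ).primeFactors →
            Nzero ⊆ (W.conductorNorm ℤ).primeFactors →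
            (∀ (ℓ : ℕ) (hℓ : ℓ ∈ (W.conductorNorm ℤ).primeFactors),
              haveI : Fact ℓ.Prime := ⟨Nat.prime_of_mem_primeFactors hℓ⟩
              (ℓ ∈ Nzero ↔ ¬ W.HasMultiplicativeReductionAtPrime ℓ) ∧
              ((ℓ ∈ Nplus ∨ ℓ ∈ Nminus) ↔ W.HasMultiplicativeReductionAtPrime ℓ) ∧ ¬ (ℓ ∈ Nplus ∧ ℓ ∈ Nminus)) →
            -- (1) `a_ℓ ≡ φ̃(ℓ) + φ̃(ℓ)⁻¹ ℓ (mod p)` for `ℓ ∤ N`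
            (∀ (ℓ : ℕ) (u : HeightOneSpectrum (𝓞 ℚ)), ℓ.Prime → ((ℓ : ℕ) : 𝓞 ℚ) ∈ u.asIdeal →
              ¬ ℓ ∣ W.conductorNorm ℤ → ∀ a : padicCoeffIntegers (∅ : Set (PadicAlgCl p)),
              θquot.HasFrobCharpolyAt u (Polynomial.X - Polynomial.C a) →
              ‖((W.LFunction ℓ : ℤ) : PadicAlgCl p) - ((a : PadicAlgCl p) + (a : PadicAlgCl p)⁻¹ * (ℓ : PadicAlgCl p))‖ < 1) →
            -- (2) `a_ℓ ≡ φ̃(ℓ)` for `ℓ ∣ N₊`;  (3) `a_ℓ ≡ φ̃(ℓ)⁻¹ ℓ` for `ℓ ∣ N₋`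
            (∀ ℓ ∈ Nplus, ∀ u : HeightOneSpectrum (𝓞 ℚ), ((ℓ : ℕ) : 𝓞 ℚ) ∈ u.asIdeal → θquot.IsUnramifiedAt u ∧
              ∀ a : padicCoeffIntegers (∅ : Set (PadicAlgCl p)), θquot.HasFrobCharpolyAt u (Polynomial.X - Polynomial.C a) →
              ‖((W.LFunction ℓ : ℤ) : PadicAlgCl p) - (a : PadicAlgCl p)‖ < 1) →
            (∀ ℓ ∈ Nminus, ∀ u : HeightOneSpectrum (𝓞 ℚ), ((ℓ : ℕ) : 𝓞 ℚ) ∈ u.asIdeal → θquot.IsUnramifiedAt u ∧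
              ∀ a : padicCoeffIntegers (∅ : Set (PadicAlgCl p)), θquot.HasFrobCharpolyAt u (Polynomial.X - Polynomial.C a) →
              ‖((W.LFunction ℓ : ℤ) : PadicAlgCl p) - (a : PadicAlgCl p)⁻¹ * (ℓ : PadicAlgCl p)‖ < 1) →
            -- (4) `a_ℓ ≡ 0` for `ℓ ∣ N₀`
            (∀ ℓ ∈ Nzero, ‖((W.LFunction ℓ : ℤ) : PadicAlgCl p)‖ < 1) →
            -- (5) (k = 2, ε_f = 𝟙; only when `φ̃ = 𝟙`, Rem. 33): `(1/24)·∏_{ℓ∣N₊}(1−ℓ)·∏_{ℓ∣N₋}(1−1)·∏_{ℓ∣N₀}(1−ℓ)(1−1) ≡ 0 (mod p)`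
            ((∀ σ : absoluteGaloisGroup ℚ, θquot σ = 1) →
              ‖(((1 : ℚ) / 24 * ((∏ ℓ ∈ Nplus, (1 - (ℓ : ℚ))) * (∏ _ℓ ∈ Nminus, ((1 : ℚ) - 1)) *
                  (∏ ℓ ∈ Nzero, (1 - (ℓ : ℚ)) * ((1 : ℚ) - 1))) : ℚ) : ℚ_[p])‖ < 1) →
          -- CGLS §2 standing hypotheses on `K` and the frames (verbatim the binders of `thm212_…` / `thm222_…`)
          ∀ (K : Type) [Field K] [NumberField K], IsImaginaryQuadratic K →
            SatisfiesHeegnerHypothesis (W.conductorNorm ℤ) K → SatisfiesHeegnerHypothesis p K →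
            Odd (NumberField.discr K) → NumberField.discr K ≠ -3 →
          ∀ (ι : K →+* ℚ_[p]) (v vbar : HeightOneSpectrum (𝓞 K)),
            (∀ x : 𝓞 K, x ∈ v.asIdeal ↔ ‖ι (x : K)‖ < 1) →
            ((p : ℕ) : 𝓞 K) ∈ vbar.asIdeal → vbar ≠ v →
          ∀ (κ : ZpExtension K p), κ.IsAnticyclotomic →
          ∀ (γ : absoluteGaloisGroup K) [Fact (κ.IsTopGenerator γ)],
          ∀ (N : ℕ) [NeZero N] (Dt : ModularParametrizationData W N),
          ∀ (ι' : PadicAlgCl p ≃+* ℂ),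
            (∀ (w : InfinitePlace K) (k : 𝓞 K), k ∈ v.asIdeal ↔ ‖ι'.symm (w.embedding (k : K))‖ < 1) →
          ∀ (θK : HeckeCharacter K), IsHeckeCharOf ι' (θquot.restrictField K) θK →
          ∀ (Cbar : Finset (HeightOneSpectrum (𝓞 K))), (∀ u ∈ Cbar, ¬ θK.IsUnramifiedAt u) →
          -- the structure map `j : ℤ_p → R₀` (`j(x) = x` in `ℂ_p`), through which `(1+T)^b`, `b ∈ ℤ_p`, is read in `R₀⟦T⟧`
          ∀ (j : ℤ_[p] →+* unrIntegers p), (∀ x : ℤ_[p], ((j x : unrIntegers p) : ℂ_[p]) = ((x : ℚ_[p]) : ℂ_[p])) →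
          -- CONCLUSION `𝓛_E ≡ (𝓔^ι_{φ,ψ})²·𝓛_φ² (mod pΛ^{ur})`, read in the frames up to a unit of `Λ^{ur} = R₀⟦T⟧`
          ∃ (ΩK : ℂ) (Ωp : (unrIntegers p)ˣ) (L : UnrSeries p), ΩK ≠ 0 ∧
            IsBDPLFunction ι' v κ γ Dt.f ΩK ((Ωp : unrIntegers p) : ℂ_[p]) L ∧
          ∃ (ΩK' : ℂ) (Ωp' : (unrIntegers p)ˣ) (Lφ : UnrSeries p), ΩK' ≠ 0 ∧
            IsKatzLFunction ι' v vbar Cbar κ γ θK ΩK' ((Ωp' : unrIntegers p) : ℂ_[p]) Lφ ∧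
          ∃ (wl : ℕ → HeightOneSpectrum (𝓞 K)) (Pq Ps : ℕ → UnrSeries p) (U : UnrSeries p), IsUnit U ∧
            (∀ ℓ ∈ (W.conductorNorm ℤ).primeFactors, ((ℓ : ℕ) : 𝓞 K) ∈ (wl ℓ).asIdeal) ∧
            (∀ ℓ ∈ (W.conductorNorm ℤ).primeFactors,
              (¬ (θquot.restrictField K).IsUnramifiedAt (wl ℓ) → Pq ℓ = 1) ∧
              ((θquot.restrictField K).IsUnramifiedAt (wl ℓ) →
                ∃ (a : padicCoeffIntegers (∅ : Set (PadicAlgCl p))) (u : unrIntegers p) (b : ℤ_[p]),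
                  (θquot.restrictField K).HasFrobCharpolyAt (wl ℓ) (Polynomial.X - Polynomial.C a) ∧
                  ‖(u : ℂ_[p]) * (ℓ : ℂ_[p]) - ((a : PadicAlgCl p) : ℂ_[p])‖ < 1 ∧
                  (b = κ.frobExponentAt (wl ℓ) ∨ b = -κ.frobExponentAt (wl ℓ)) ∧
                  Pq ℓ = 1 - C u * (binomialSeries ℤ_[p] b).map j)) ∧
            (∀ ℓ ∈ (W.conductorNorm ℤ).primeFactors,
              (¬ (θsub.restrictField K).IsUnramifiedAt (wl ℓ) → Ps ℓ = 1) ∧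
              ((θsub.restrictField K).IsUnramifiedAt (wl ℓ) →
                ∃ (a : padicCoeffIntegers (∅ : Set (PadicAlgCl p))) (u : unrIntegers p) (b : ℤ_[p]),
                  (θsub.restrictField K).HasFrobCharpolyAt (wl ℓ) (Polynomial.X - Polynomial.C a) ∧
                  ‖(u : ℂ_[p]) * (ℓ : ℂ_[p]) - ((a : PadicAlgCl p) : ℂ_[p])‖ < 1 ∧
                  (b = κ.frobExponentAt (wl ℓ) ∨ b = -κ.frobExponentAt (wl ℓ)) ∧
                  Ps ℓ = 1 - C u * (binomialSeries ℤ_[p] b).map j)) ∧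
            ∀ i : ℕ, ‖((coeff i L : unrIntegers p) : ℂ_[p]) -
              ((coeff i (U * ((∏ ℓ ∈ Nzero ∪ Nminus, Pq ℓ) * (∏ ℓ ∈ Nzero ∪ Nplus, Ps ℓ)) ^ 2 * Lφ ^ 2) :
                unrIntegers p) : ℂ_[p])‖ < 1) :
    Summit.BirchSwinnertonDyer.BirchSwinnertonDyer.Theses.EisensteinPrimes.GoodLatticeBDPValue :=
  GoodLatticeBDPValueOfNamedFactsV34.goodLatticeBDPValue_of_namedFacts₃₄ ⟨h4, thm212_of_exists_frame_form hIex⟩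
    (GoodLatticeKatzFrameRigidity.proofThm221_congruence_of_existsFramePair h221ex)
    (GoodLatticeKatzFrameRigidity.thmI_mu_katzLFunction_eq_zero_of_exists_frame hIex)

/-- **The crux's SIGNATURE as a Literature `Prop` — `KellerYin2024.thm308_imc2_bdpValue_goodLattice_OPEN` — from the same six
`∃`-shaped statements** (the route decl unfolds to this `Prop`; stated on the Literature name so that every route reading it can cite one
theorem). CONDITIONAL; the `Prop` keeps its `_OPEN` label; BSD is proved for no curve.
[cite: KellerYin2024, Thm. 3.0.8 (IMC2) (arXiv:2402.12781v2 TeX L1618–L1640) — statement shape] [cite: CastellaGrossiLeeSkinner2022, proof of Thm. 4.2.2, Thm. 5.1.3 with (disc), Thm. 2.1.2, Thm. 2.2.1]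
[cite: Hida2010MuInvariant, Thm. I] [cite: BleherEtAl2020, §3.3 Thm. 3.3.1] [cite: deShalit1987, II.6.4 Theorem (i)] -/
theorem thm308_imc2_bdpValue_goodLattice_OPEN_of_existsFrameForms
    (h4 : proofThm422_exists_isBDPLFunction_isTorsion_charIdeal_dvd ∧
      thm513_exists_isBDPLFunction_valueAtOne_disc ∧
      thm331_rubin_exists_katzMeasure₂_pseudoIso_span_eq ∧
      thmII64_katzMeasure₂_functionalEquation)
    (hIex :
        ∀ (p : ℕ) [Fact p.Prime], 2 < p →
          ∀ (K : Type) [Field K] [NumberField K], IsImaginaryQuadratic K →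
            SatisfiesHeegnerHypothesis p K → Odd (NumberField.discr K) → NumberField.discr K ≠ -3 →
          ∀ (ι : K →+* ℚ_[p]) (v vbar : HeightOneSpectrum (𝓞 K)),
            (∀ x : 𝓞 K, x ∈ v.asIdeal ↔ ‖ι (x : K)‖ < 1) →
            ((p : ℕ) : 𝓞 K) ∈ vbar.asIdeal → vbar ≠ v →
          ∀ (κ : ZpExtension K p), κ.IsAnticyclotomic →
          ∀ (γ : absoluteGaloisGroup K) [Fact (κ.IsTopGenerator γ)],
          ∀ (ι' : PadicAlgCl p ≃+* ℂ),
            (∀ (w : InfinitePlace K) (k : 𝓞 K), k ∈ v.asIdeal ↔ ‖ι'.symm (w.embedding (k : K))‖ < 1) →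
          ∀ (θ : FramedGaloisRep ℚ (padicCoeffIntegers (∅ : Set (PadicAlgCl p))) 1),
            (∀ σ : absoluteGaloisGroup ℚ, θ σ ^ (p - 1) = 1) →
          ∀ (C : ℕ), SatisfiesHeegnerHypothesis C K →
            (∀ u : HeightOneSpectrum (𝓞 ℚ), ((C : ℤ) : 𝓞 ℚ) ∉ u.asIdeal → θ.IsUnramifiedAt u) →
            (∀ u : HeightOneSpectrum (𝓞 ℚ), ((p : ℕ) : 𝓞 ℚ) ∈ u.asIdeal → θ.IsUnramifiedAt u) →
          ∀ (θK : HeckeCharacter K), IsHeckeCharOf ι' (θ.restrictField K) θK →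
          ∃ (ΩK : ℂ) (Ωp : (unrIntegers p)ˣ) (L : UnrSeries p), ΩK ≠ 0 ∧
            IsKatzLFunction ι' v vbar ∅ κ γ θK ΩK ((Ωp : unrIntegers p) : ℂ_[p]) L ∧ ∃ n : ℕ, FirstUnitCoeffAt L n)
    (h221ex :
        ∀ (W : WeierstrassCurve ℚ) [W.IsElliptic] [W.IsGloballyMinimal] (p : ℕ) [Fact p.Prime],
          2 < p → Good W p →
          -- `E[p]^{ss} ≅ 𝔽_p(φ) ⊕ 𝔽_p(ψ)`: a rational line `Φ ≤ E[p]` with Teichmüller lifts `θsub = ψ̃` (on `Φ`) and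
          -- `θquot = φ̃` (on `E[p]/Φ`); "labeled so that `p ∤ cond(φ)`": `θquot` unramified at `p`
          ∀ (Φ : AddSubgroup (geomTorsion W (p : ℤ))), IsRationalLine W p Φ →
          ∀ (θsub θquot : FramedGaloisRep ℚ (padicCoeffIntegers (∅ : Set (PadicAlgCl p))) 1),
            IsTeichmullerLiftOn (∅ : Set (PadicAlgCl p)) (Φ.map (geomTorsion W (p : ℤ)).subtype) θsub →
            IsTeichmullerLiftOnQuot (∅ : Set (PadicAlgCl p)) (Φ.map (geomTorsion W (p : ℤ)).subtype)
              (geomTorsion W (p : ℤ)) θquot →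
            (∀ u : HeightOneSpectrum (𝓞 ℚ), ((p : ℕ) : 𝓞 ℚ) ∈ u.asIdeal → θquot.IsUnramifiedAt u) →
          -- (eq:cong-mf) `f ≡ E₂^{φ,φ⁻¹,(N)} (mod p)` ⟸ FULL Eisenstein descent of type `(φ̃, φ̃⁻¹, N₊, N₋, N₀)` mod `p`
          -- (Kriz 2016 Def. 31 with Rem. 32): the TYPE — `N₀` = the additive primes (squarefull part), `N₊ ⊔ N₋` = the
          -- multiplicative primes (squarefree part) of `N_E`
          ∀ (Nplus Nminus Nzero : Finset ℕ),
            Nplus ⊆ (W.conductorNorm ℤ).primeFactors → Nminus ⊆ (W.conductorNorm ℤ).primeFactors →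
            Nzero ⊆ (W.conductorNorm ℤ).primeFactors →
            (∀ (ℓ : ℕ) (hℓ : ℓ ∈ (W.conductorNorm ℤ).primeFactors),
              haveI : Fact ℓ.Prime := ⟨Nat.prime_of_mem_primeFactors hℓ⟩
              (ℓ ∈ Nzero ↔ ¬ W.HasMultiplicativeReductionAtPrime ℓ) ∧
              ((ℓ ∈ Nplus ∨ ℓ ∈ Nminus) ↔ W.HasMultiplicativeReductionAtPrime ℓ) ∧ ¬ (ℓ ∈ Nplus ∧ ℓ ∈ Nminus)) →
            -- (1) `a_ℓ ≡ φ̃(ℓ) + φ̃(ℓ)⁻¹ ℓ (mod p)` for `ℓ ∤ N`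
            (∀ (ℓ : ℕ) (u : HeightOneSpectrum (𝓞 ℚ)), ℓ.Prime → ((ℓ : ℕ) : 𝓞 ℚ) ∈ u.asIdeal →
              ¬ ℓ ∣ W.conductorNorm ℤ → ∀ a : padicCoeffIntegers (∅ : Set (PadicAlgCl p)),
              θquot.HasFrobCharpolyAt u (Polynomial.X - Polynomial.C a) →
              ‖((W.LFunction ℓ : ℤ) : PadicAlgCl p) - ((a : PadicAlgCl p) + (a : PadicAlgCl p)⁻¹ * (ℓ : PadicAlgCl p))‖ < 1) →
            -- (2) `a_ℓ ≡ φ̃(ℓ)` for `ℓ ∣ N₊`;  (3) `a_ℓ ≡ φ̃(ℓ)⁻¹ ℓ` for `ℓ ∣ N₋`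
            (∀ ℓ ∈ Nplus, ∀ u : HeightOneSpectrum (𝓞 ℚ), ((ℓ : ℕ) : 𝓞 ℚ) ∈ u.asIdeal → θquot.IsUnramifiedAt u ∧
              ∀ a : padicCoeffIntegers (∅ : Set (PadicAlgCl p)), θquot.HasFrobCharpolyAt u (Polynomial.X - Polynomial.C a) →
              ‖((W.LFunction ℓ : ℤ) : PadicAlgCl p) - (a : PadicAlgCl p)‖ < 1) →
            (∀ ℓ ∈ Nminus, ∀ u : HeightOneSpectrum (𝓞 ℚ), ((ℓ : ℕ) : 𝓞 ℚ) ∈ u.asIdeal → θquot.IsUnramifiedAt u ∧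
              ∀ a : padicCoeffIntegers (∅ : Set (PadicAlgCl p)), θquot.HasFrobCharpolyAt u (Polynomial.X - Polynomial.C a) →
              ‖((W.LFunction ℓ : ℤ) : PadicAlgCl p) - (a : PadicAlgCl p)⁻¹ * (ℓ : PadicAlgCl p)‖ < 1) →
            -- (4) `a_ℓ ≡ 0` for `ℓ ∣ N₀`
            (∀ ℓ ∈ Nzero, ‖((W.LFunction ℓ : ℤ) : PadicAlgCl p)‖ < 1) →
            -- (5) (k = 2, ε_f = 𝟙; only when `φ̃ = 𝟙`, Rem. 33): `(1/24)·∏_{ℓ∣N₊}(1−ℓ)·∏_{ℓ∣N₋}(1−1)·∏_{ℓ∣N₀}(1−ℓ)(1−1) ≡ 0 (mod p)`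
            ((∀ σ : absoluteGaloisGroup ℚ, θquot σ = 1) →
              ‖(((1 : ℚ) / 24 * ((∏ ℓ ∈ Nplus, (1 - (ℓ : ℚ))) * (∏ _ℓ ∈ Nminus, ((1 : ℚ) - 1)) *
                  (∏ ℓ ∈ Nzero, (1 - (ℓ : ℚ)) * ((1 : ℚ) - 1))) : ℚ) : ℚ_[p])‖ < 1) →
          -- CGLS §2 standing hypotheses on `K` and the frames (verbatim the binders of `thm212_…` / `thm222_…`)
          ∀ (K : Type) [Field K] [NumberField K], IsImaginaryQuadratic K →
            SatisfiesHeegnerHypothesis (W.conductorNorm ℤ) K → SatisfiesHeegnerHypothesis p K →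
            Odd (NumberField.discr K) → NumberField.discr K ≠ -3 →
          ∀ (ι : K →+* ℚ_[p]) (v vbar : HeightOneSpectrum (𝓞 K)),
            (∀ x : 𝓞 K, x ∈ v.asIdeal ↔ ‖ι (x : K)‖ < 1) →
            ((p : ℕ) : 𝓞 K) ∈ vbar.asIdeal → vbar ≠ v →
          ∀ (κ : ZpExtension K p), κ.IsAnticyclotomic →
          ∀ (γ : absoluteGaloisGroup K) [Fact (κ.IsTopGenerator γ)],
          ∀ (N : ℕ) [NeZero N] (Dt : ModularParametrizationData W N),
          ∀ (ι' : PadicAlgCl p ≃+* ℂ),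
            (∀ (w : InfinitePlace K) (k : 𝓞 K), k ∈ v.asIdeal ↔ ‖ι'.symm (w.embedding (k : K))‖ < 1) →
          ∀ (θK : HeckeCharacter K), IsHeckeCharOf ι' (θquot.restrictField K) θK →
          ∀ (Cbar : Finset (HeightOneSpectrum (𝓞 K))), (∀ u ∈ Cbar, ¬ θK.IsUnramifiedAt u) →
          -- the structure map `j : ℤ_p → R₀` (`j(x) = x` in `ℂ_p`), through which `(1+T)^b`, `b ∈ ℤ_p`, is read in `R₀⟦T⟧`
          ∀ (j : ℤ_[p] →+* unrIntegers p), (∀ x : ℤ_[p], ((j x : unrIntegers p) : ℂ_[p]) = ((x : ℚ_[p]) : ℂ_[p])) →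
          -- CONCLUSION `𝓛_E ≡ (𝓔^ι_{φ,ψ})²·𝓛_φ² (mod pΛ^{ur})`, read in the frames up to a unit of `Λ^{ur} = R₀⟦T⟧`
          ∃ (ΩK : ℂ) (Ωp : (unrIntegers p)ˣ) (L : UnrSeries p), ΩK ≠ 0 ∧
            IsBDPLFunction ι' v κ γ Dt.f ΩK ((Ωp : unrIntegers p) : ℂ_[p]) L ∧
          ∃ (ΩK' : ℂ) (Ωp' : (unrIntegers p)ˣ) (Lφ : UnrSeries p), ΩK' ≠ 0 ∧
            IsKatzLFunction ι' v vbar Cbar κ γ θK ΩK' ((Ωp' : unrIntegers p) : ℂ_[p]) Lφ ∧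
          ∃ (wl : ℕ → HeightOneSpectrum (𝓞 K)) (Pq Ps : ℕ → UnrSeries p) (U : UnrSeries p), IsUnit U ∧
            (∀ ℓ ∈ (W.conductorNorm ℤ).primeFactors, ((ℓ : ℕ) : 𝓞 K) ∈ (wl ℓ).asIdeal) ∧
            (∀ ℓ ∈ (W.conductorNorm ℤ).primeFactors,
              (¬ (θquot.restrictField K).IsUnramifiedAt (wl ℓ) → Pq ℓ = 1) ∧
              ((θquot.restrictField K).IsUnramifiedAt (wl ℓ) →
                ∃ (a : padicCoeffIntegers (∅ : Set (PadicAlgCl p))) (u : unrIntegers p) (b : ℤ_[p]),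
                  (θquot.restrictField K).HasFrobCharpolyAt (wl ℓ) (Polynomial.X - Polynomial.C a) ∧
                  ‖(u : ℂ_[p]) * (ℓ : ℂ_[p]) - ((a : PadicAlgCl p) : ℂ_[p])‖ < 1 ∧
                  (b = κ.frobExponentAt (wl ℓ) ∨ b = -κ.frobExponentAt (wl ℓ)) ∧
                  Pq ℓ = 1 - C u * (binomialSeries ℤ_[p] b).map j)) ∧
            (∀ ℓ ∈ (W.conductorNorm ℤ).primeFactors,
              (¬ (θsub.restrictField K).IsUnramifiedAt (wl ℓ) → Ps ℓ = 1) ∧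
              ((θsub.restrictField K).IsUnramifiedAt (wl ℓ) →
                ∃ (a : padicCoeffIntegers (∅ : Set (PadicAlgCl p))) (u : unrIntegers p) (b : ℤ_[p]),
                  (θsub.restrictField K).HasFrobCharpolyAt (wl ℓ) (Polynomial.X - Polynomial.C a) ∧
                  ‖(u : ℂ_[p]) * (ℓ : ℂ_[p]) - ((a : PadicAlgCl p) : ℂ_[p])‖ < 1 ∧
                  (b = κ.frobExponentAt (wl ℓ) ∨ b = -κ.frobExponentAt (wl ℓ)) ∧
                  Ps ℓ = 1 - C u * (binomialSeries ℤ_[p] b).map j)) ∧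
            ∀ i : ℕ, ‖((coeff i L : unrIntegers p) : ℂ_[p]) -
              ((coeff i (U * ((∏ ℓ ∈ Nzero ∪ Nminus, Pq ℓ) * (∏ ℓ ∈ Nzero ∪ Nplus, Ps ℓ)) ^ 2 * Lφ ^ 2) :
                unrIntegers p) : ℂ_[p])‖ < 1) :
    KellerYin2024.thm308_imc2_bdpValue_goodLattice_OPEN :=
  goodLatticeBDPValue_of_existsFrameForms h4 hIex h221ex

end Summit.BirchSwinnertonDyer.BirchSwinnertonDyer.Theorems.GoodLatticeBDPValueOfExistsFrameForms

end
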